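import Summits.AtomisticToContinuum.Crystallization.Theorems.PalmUnimodularRigidityMinimiserShellsInSituTransfer
import Summits.AtomisticToContinuum.Crystallization.Theorems.PalmUnimodularRigidityMinimiserShellsExactResidual

/-!
# Crux `MinimiserShells` (stmt-AtomisticToContinuum-9225): two-level coarse-to-fine vocabulary and the level cascade

Route `PalmUnimodularRigidity`, line `exact-elastic-split` (lead c19, 2026-08-17): step (P0) of the line card
`Cruxes/MinimiserShells/Lines/exact-elastic-split.md` as landed lemmas.  The crux is kernel-certified equal to
`∀ θ ∈ (0, 1/10], Residual.ShellGap θ` (p149424) and splits exactly into the open core `ShellGap (1/20)` and the e*-free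
child `∀ θ ∈ (0, 1/20], CoarseToFineAt (1/20) θ` (strategist s1, `ExactSplit`).  Here: the TWO-LEVEL periodic gap
`CoarseToFineAt θc θf` and finite-cluster inequality `ClusterCoerciveAt θc θf` (read-backs at `θc = 1/20` to the route
child and to the registered stub `stub_clusterCoercivityLoose`, both `Iff.rfl`); the LEVEL CASCADE
`coarseToFineAt_trans` (no order hypotheses), monotonicity in either level, `ShellGap θc → CoarseToFineAt θc θf → ShellGap θf`,
the LADDER theorems (rungs along any antitone sequence `1/20 = θ 0 ≥ θ 1 ≥ … → 0` give the whole child; dyadic instance);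
the TWO-LEVEL TRANSFER `coarseToFineAt_of_clusterCoerciveAt` (cluster ⇒ in-situ ⇒ periodic, both levels free — the
level-`(1/20, θ)` instance is the strategist's `looseInSituTransfer`/`loosePeriodicAssembly`, after p139420 / p138462 whose
cores are generic in the shell predicates); and the compositions with the coarse gap down to the crux (p149424), incl. the
registered `minimiserShells_of_coarseGap_and_dyadicRungs`.  So a prover attacking the e*-free half may insert levels at
will (`1/20 → 1/40 → 1/80 → …`: the first rung carries the non-convex part of the 6 % tube, later rungs live within
`3.5 %` of the patterns) and prove ONE finite-cluster rung at a time.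
-/

noncomputable section

open MeasureTheory
open scoped ENNReal BigOperators Classical

namespace Summit.AtomisticToContinuum.Crystallization.Theorems.PalmUnimodularRigidityMinimiserShells.TwoLevel

open Literature.MathematicalPhysics.StatisticalMechanics (lennardJones siteEnergy interactionEnergy PeriodicConfiguration)
open Summit.AtomisticToContinuum.Crystallization.Theses.PalmUnimodularRigidity (MinimiserShells)
open Summit.AtomisticToContinuum.Crystallization.Theorems.MinimiserShells.Negative.LoadBearing (eStar)
open Summit.AtomisticToContinuum.Crystallization.Theorems.MinimiserShells.Negative.Rootedness (E3)
open Summit.AtomisticToContinuum.Crystallization.Theorems.PalmUnimodularRigidityMinimiserShells.Residual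
  (ShellGap IsSepThird looseBadMotifCount LooseGoodShell rerooted looseBadMotifCount_anti shellGap_mono)
open Summit.AtomisticToContinuum.Crystallization.Theorems.PalmUnimodularRigidityMinimiserShells.ExactResidual
  (minimiserShells_of_shellGapAll)
open Summit.AtomisticToContinuum.Crystallization.Theorems.PalmUnimodularRigidityMinimiserShells.InSituTransfer
  (mem_of_map_eq sum_siteEnergy_eq cross_sum_ge congr_of_deep card_coarseBad_le card_le_of_imp)
open Summit.AtomisticToContinuum.Crystallization.Theorems.PalmUnimodularRigidityMinimiserShells.PeriodicAssembly
  (exists_blocks₂ le_interactionEnergy_of_local)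
open Summit.AtomisticToContinuum.Crystallization.Theorems.PalmUnimodularRigidityMinimiserShells

/-! ## The two-level statements -/

/-- **Two-level periodic coarse-to-fine shell gap** from level `θc` to level `θf`: for every `t > 0` there are `s, κ > 0`
such that every `1/3`-separated periodic `Q` with at least `t·#motif` `θf`-loosely bad and fewer than `s·#motif` `θc`-loosely
bad motif sites has `e(Q) ≥ e* + κ`.  The route child `CoarseToFineShellGapAll` is the family `CoarseToFineAt (1/20) θ`. -/
def CoarseToFineAt (θc θf : ℝ) : Prop :=
  ∀ t : ℝ, 0 < t → ∃ s : ℝ, 0 < s ∧ ∃ κ : ℝ, 0 < κ ∧ ∀ Q : PeriodicConfiguration 3, IsSepThird Q →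
    t * (Q.motif.card : ℝ) ≤ (looseBadMotifCount θf Q : ℝ) →
    (looseBadMotifCount θc Q : ℝ) < s * (Q.motif.card : ℝ) →
    eStar + κ ≤ Q.energyPerParticle lennardJones

/-- **Two-level finite-cluster coercivity** from the coarse level `θc` to the fine level `θf`: some `c > 0` admits, for
every slack `ε > 0`, a radius `R > 0` and a charge `C ≥ 0` such that every finite injective `1/3`-separated cluster `y`
has `c·#{i : θf-loosely bad, every j within R of i θc-loosely good} − C·#{j : θc-loosely bad} − ε·N ≤ 𝓔_N(y) − N·e*`.
The registered stub `stub_clusterCoercivityLoose` is the family `ClusterCoerciveAt (1/20) θ` (`clusterCoerciveAt_twentieth_iff`). -/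
def ClusterCoerciveAt (θc θf : ℝ) : Prop :=
  ∃ c : ℝ, 0 < c ∧ ∀ ε : ℝ, 0 < ε → ∃ R : ℝ, 0 < R ∧ ∃ C : ℝ, 0 ≤ C ∧
    ∀ (N : ℕ) (y : Fin N → E3), Function.Injective y →
      (∀ i j : Fin N, i ≠ j → (1 : ℝ) / 3 ≤ dist (y i) (y j)) →
      c * (Nat.card {i : Fin N //
            ¬ LooseGoodShell θf ((Measure.count : Measure E3).restrict ((fun z => z - y i) '' Set.range y)) ∧
            ∀ j : Fin N, dist (y i) (y j) ≤ R →
              LooseGoodShell θc ((Measure.count : Measure E3).restrict ((fun z => z - y j) '' Set.range y))} : ℝ)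
        - C * (Nat.card {j : Fin N //
            ¬ LooseGoodShell θc ((Measure.count : Measure E3).restrict ((fun z => z - y j) '' Set.range y))} : ℝ)
        - ε * (N : ℝ)
      ≤ interactionEnergy lennardJones y - (N : ℝ) * eStar

/-! ## Read-backs at the coarse level `1/20` -/

/-- The family `CoarseToFineAt (1/20) θ`, `θ ∈ (0, 1/20]`, IS the route child `CoarseToFineShellGapAll` in residual
vocabulary (the right-hand side of `ExactSplit.coarseToFineShellGapAllStmt_iff`). -/
theorem coarseToFineAt_twentieth_iff :
    (∀ θ : ℝ, 0 < θ → θ ≤ 1 / 20 → CoarseToFineAt (1 / 20) θ) ↔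
    (∀ θ : ℝ, 0 < θ → θ ≤ 1 / 20 → ∀ t : ℝ, 0 < t → ∃ s : ℝ, 0 < s ∧ ∃ κ : ℝ, 0 < κ ∧
      ∀ Q : PeriodicConfiguration 3, IsSepThird Q →
      t * (Q.motif.card : ℝ) ≤ (looseBadMotifCount θ Q : ℝ) →
      (looseBadMotifCount (1 / 20) Q : ℝ) < s * (Q.motif.card : ℝ) →
      eStar + κ ≤ Q.energyPerParticle lennardJones) :=
  Iff.rfl

/-- The family `ClusterCoerciveAt (1/20) θ`, `θ ∈ (0, 1/20]`, IS the registered stub `stub_clusterCoercivityLoose` of line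
`exact-elastic-split`. -/
theorem clusterCoerciveAt_twentieth_iff :
    (∀ θ : ℝ, 0 < θ → θ ≤ 1 / 20 → ClusterCoerciveAt (1 / 20) θ) ↔
    (∀ θ : ℝ, 0 < θ → θ ≤ 1 / 20 →
      ∃ c : ℝ, 0 < c ∧ ∀ ε : ℝ, 0 < ε → ∃ R : ℝ, 0 < R ∧ ∃ C : ℝ, 0 ≤ C ∧
        ∀ (N : ℕ) (y : Fin N → E3), Function.Injective y →
          (∀ i j : Fin N, i ≠ j → (1 : ℝ) / 3 ≤ dist (y i) (y j)) →
          c * (Nat.card {i : Fin N //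
                ¬ LooseGoodShell θ ((Measure.count : Measure E3).restrict ((fun z => z - y i) '' Set.range y)) ∧
                ∀ j : Fin N, dist (y i) (y j) ≤ R →
                  LooseGoodShell (1 / 20)
                    ((Measure.count : Measure E3).restrict ((fun z => z - y j) '' Set.range y))} : ℝ)
            - C * (Nat.card {j : Fin N //
                ¬ LooseGoodShell (1 / 20)
                  ((Measure.count : Measure E3).restrict ((fun z => z - y j) '' Set.range y))} : ℝ)
            - ε * (N : ℝ)
          ≤ interactionEnergy lennardJones y - (N : ℝ) * eStar) :=
  Iff.rfl

/-! ## The level cascade (periodic level) -/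

/-- **LEVEL CASCADE** `CoarseToFineAt θ₁ θ₂ → CoarseToFineAt θ₂ θ₃ → CoarseToFineAt θ₁ θ₃` (no order hypotheses): take
`s₂, κ₂` from the second gap at `t`, `s₁, κ₁` from the first at threshold `s₂`, and split on the `θ₂`-bad fraction. -/
theorem coarseToFineAt_trans {θ₁ θ₂ θ₃ : ℝ} (h₁₂ : CoarseToFineAt θ₁ θ₂) (h₂₃ : CoarseToFineAt θ₂ θ₃) :
    CoarseToFineAt θ₁ θ₃ := by
  intro t ht
  obtain ⟨s₂, hs₂, κ₂, hκ₂, H₂⟩ := h₂₃ t ht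
  obtain ⟨s₁, hs₁, κ₁, hκ₁, H₁⟩ := h₁₂ s₂ hs₂
  refine ⟨s₁, hs₁, min κ₁ κ₂, lt_min hκ₁ hκ₂, fun Q hsep hbad hsparse => ?_⟩
  by_cases hc : s₂ * (Q.motif.card : ℝ) ≤ (looseBadMotifCount θ₂ Q : ℝ)
  · exact le_trans (add_le_add le_rfl (min_le_left _ _)) (H₁ Q hsep hc hsparse)
  · exact le_trans (add_le_add le_rfl (min_le_right _ _)) (H₂ Q hsep hbad (not_le.mp hc))

/-- Loosening the fine level weakens the gap's hypothesis: `CoarseToFineAt θc θf → CoarseToFineAt θc θf'` for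
`0 ≤ θf ≤ θf' ≤ 1/10` (antitonicity of the loose bad counts). -/
theorem coarseToFineAt_mono_fine {θc θf θf' : ℝ} (hf : 0 ≤ θf) (hff' : θf ≤ θf') (hf' : θf' ≤ 1 / 10)
    (h : CoarseToFineAt θc θf) : CoarseToFineAt θc θf' := by
  intro t ht
  obtain ⟨s, hs, κ, hκ, H⟩ := h t ht
  refine ⟨s, hs, κ, hκ, fun Q hsep hbad hsparse => H Q hsep (hbad.trans ?_) hsparse⟩
  exact_mod_cast looseBadMotifCount_anti hf hff' hf' Q

/-- Tightening the coarse level weakens the gap's hypothesis: `CoarseToFineAt θc θf → CoarseToFineAt θc' θf` for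
`0 ≤ θc' ≤ θc ≤ 1/10`. -/
theorem coarseToFineAt_mono_coarse {θc θc' θf : ℝ} (hc' : 0 ≤ θc') (hcc : θc' ≤ θc) (hc : θc ≤ 1 / 10)
    (h : CoarseToFineAt θc θf) : CoarseToFineAt θc' θf := by
  intro t ht
  obtain ⟨s, hs, κ, hκ, H⟩ := h t ht
  refine ⟨s, hs, κ, hκ, fun Q hsep hbad hsparse => H Q hsep hbad (lt_of_le_of_lt ?_ hsparse)⟩
  exact_mod_cast looseBadMotifCount_anti hc' hcc hc Q

/-- A full gap at the fine level is a coarse-to-fine gap from any coarse level (`s = 1`, sparsity unused). -/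
theorem coarseToFineAt_of_shellGap {θc θf : ℝ} (h : ShellGap θf) : CoarseToFineAt θc θf := by
  intro t ht
  obtain ⟨κ, hκ, H⟩ := h t ht
  exact ⟨1, one_pos, κ, hκ, fun Q hsep hbad _ => H Q hsep hbad⟩

/-- **Coarse gap + coarse-to-fine gap = fine gap**: `ShellGap θc → CoarseToFineAt θc θf → ShellGap θf` (case split at the
coarse threshold `s`). -/
theorem shellGap_of_coarseToFineAt {θc θf : ℝ} (hc : ShellGap θc) (h : CoarseToFineAt θc θf) : ShellGap θf := by
  intro t ht
  obtain ⟨s, hs, κ₂, hκ₂, H₂⟩ := h t ht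
  obtain ⟨κ₁, hκ₁, H₁⟩ := hc s hs
  refine ⟨min κ₁ κ₂, lt_min hκ₁ hκ₂, fun Q hsep hbad => ?_⟩
  by_cases hcase : s * (Q.motif.card : ℝ) ≤ (looseBadMotifCount θc Q : ℝ)
  · exact le_trans (add_le_add le_rfl (min_le_left _ _)) (H₁ Q hsep hcase)
  · exact le_trans (add_le_add le_rfl (min_le_right _ _)) (H₂ Q hsep hbad (not_le.mp hcase))

/-- **THE LADDER**: along an antitone sequence `1/20 = θ 0 ≥ θ 1 ≥ … ≥ 0` reaching below every positive level, the rungs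
`CoarseToFineAt (θ k) (θ (k+1))` give the whole e*-free child (cascade along the chain, then loosen the fine level). -/
theorem child_of_ladder (θ : ℕ → ℝ) (h0 : θ 0 = 1 / 20) (hpos : ∀ k, 0 ≤ θ k)
    (hanti : ∀ k, θ (k + 1) ≤ θ k) (hreach : ∀ η : ℝ, 0 < η → ∃ k, θ k ≤ η)
    (hrung : ∀ k, CoarseToFineAt (θ k) (θ (k + 1))) :
    ∀ θ' : ℝ, 0 < θ' → θ' ≤ 1 / 20 → CoarseToFineAt (1 / 20) θ' := by
  have hchain : ∀ k, CoarseToFineAt (θ 0) (θ (k + 1)) := by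
    intro k
    induction k with
    | zero => exact hrung 0
    | succ k ih => exact coarseToFineAt_trans ih (hrung (k + 1))
  intro θ' hθ' hθ'20
  obtain ⟨k, hk⟩ := hreach θ' hθ'
  rw [← h0]
  exact coarseToFineAt_mono_fine (hpos (k + 1)) ((hanti k).trans hk) (hθ'20.trans (by norm_num)) (hchain k)

/-- The dyadic levels `(1/20)/2^k` reach below every positive level. -/
theorem dyadic_reach (η : ℝ) (hη : 0 < η) : ∃ k : ℕ, (1 / 20 : ℝ) / 2 ^ k ≤ η := by
  obtain ⟨k, hk⟩ := exists_pow_lt_of_lt_one (show 0 < η * 20 by positivity) (by norm_num : (1 / 2 : ℝ) < 1)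
  refine ⟨k, ?_⟩
  rw [div_le_iff₀ (by positivity)]
  have h2 : (1 / 2 : ℝ) ^ k * 2 ^ k = 1 := by rw [← mul_pow]; norm_num
  nlinarith [mul_le_mul_of_nonneg_right hk.le (by positivity : (0 : ℝ) ≤ 2 ^ k)]

/-- **Dyadic ladder**: the rungs `CoarseToFineAt ((1/20)/2^k) ((1/20)/2^(k+1))`, `k : ℕ`, give the whole e*-free child. -/
theorem child_of_dyadicLadder
    (hrung : ∀ k : ℕ, CoarseToFineAt ((1 / 20 : ℝ) / 2 ^ k) ((1 / 20 : ℝ) / 2 ^ (k + 1))) :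
    ∀ θ' : ℝ, 0 < θ' → θ' ≤ 1 / 20 → CoarseToFineAt (1 / 20) θ' := by
  refine child_of_ladder (fun k => (1 / 20 : ℝ) / 2 ^ k) (by norm_num) (fun k => by positivity) (fun k => ?_)
    dyadic_reach hrung
  rw [pow_succ]
  exact div_le_div_of_nonneg_left (by norm_num) (by positivity) (le_mul_of_one_le_right (by positivity) (by norm_num))

/-- **Coarse gap + the child give every loosened gap** `ShellGap θ`, `θ ∈ (0, 1/10]` (case split at `1/20`). -/
theorem shellGapAll_of_coarse_and_child (hc : ShellGap (1 / 20))
    (hchild : ∀ θ' : ℝ, 0 < θ' → θ' ≤ 1 / 20 → CoarseToFineAt (1 / 20) θ') :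
    ∀ θ : ℝ, 0 < θ → θ ≤ 1 / 10 → ShellGap θ := by
  intro θ hθ hθ'
  by_cases hle : θ ≤ 1 / 20
  · exact shellGap_of_coarseToFineAt hc (hchild θ hθ hle)
  · exact shellGap_mono (1 / 20) θ (by norm_num) (le_of_lt (not_le.mp hle)) hθ' hc

/-! ## The two-level transfer: cluster coercivity ⇒ in-situ local inequality ⇒ periodic gap -/

/-- **`θf`-loosely bad off the `R`-boundary transfers to `y|Ω`, two levels** (after `InSituTransfer.fineBad_transfer`,
p139420): with `Ω` `θc`-loosely good in `y`, `R ≥ R₀ + 5/4`, a `θf`-bad `e a` with no index outside `Ω` within `R` stays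
`θf`-bad in `y ∘ e`, and its `R₀`-ball stays `θc`-good there. -/
theorem looseFineBad_transfer₂ {N M : ℕ} (y : Fin N → E3) {Ω : Finset (Fin N)} {e : Fin M ↪ Fin N}
    (hΩe : Finset.univ.map e = Ω) {θf θc R₀ R : ℝ} (hθf : 0 ≤ θf) (hθc : 0 ≤ θc) (hR₀ : 0 ≤ R₀)
    (hR : R₀ + 5 / 4 ≤ R)
    (hΩ : ∀ i ∈ Ω, LooseGoodShell θc
      ((Measure.count : Measure E3).restrict ((fun z => z - y i) '' Set.range y)))
    (a : Fin M)
    (hbad : ¬ LooseGoodShell θf ((Measure.count : Measure E3).restrict ((fun z => z - y (e a)) '' Set.range y)))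
    (hfar : ¬ ∃ j : Fin N, j ∉ Ω ∧ dist (y (e a)) (y j) ≤ R) :
    ¬ LooseGoodShell θf ((Measure.count : Measure E3).restrict ((fun z => z - y (e a)) '' Set.range (y ∘ e))) ∧
      ∀ b : Fin M, dist (y (e a)) (y (e b)) ≤ R₀ →
        LooseGoodShell θc ((Measure.count : Measure E3).restrict ((fun z => z - y (e b)) '' Set.range (y ∘ e))) := by
  have hin : ∀ k : Fin N, dist (y (e a)) (y k) ≤ R → k ∈ Ω := fun k hk => by
    by_contra hkΩ
    exact hfar ⟨k, hkΩ, hk⟩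
  refine ⟨fun hgood => hbad ((congr_of_deep (G := LooseGoodShell θf)
    (fun h => NecessityBlocks.looseGood_congr_of_local hθf h) y hΩe (by linarith : (5 : ℝ) / 4 ≤ R) hin).2 hgood),
    fun b hb => ?_⟩
  refine (congr_of_deep (G := LooseGoodShell θc) (fun h => NecessityBlocks.looseGood_congr_of_local hθc h)
    y hΩe le_rfl fun k hk => hin k ?_).1 (hΩ _ (mem_of_map_eq hΩe b))
  calc dist (y (e a)) (y k) ≤ dist (y (e a)) (y (e b)) + dist (y (e b)) (y k) := dist_triangle _ _ _
    _ ≤ R₀ + 5 / 4 := add_le_add hb hk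
    _ ≤ R := hR

/-- **`θf`-loosely bad indices of `Ω` are priced in `y|Ω` up to the `R`-boundary, two levels** (after
`InSituTransfer.card_fineBad_le`). -/
theorem card_looseFineBad_le₂ {N M : ℕ} (y : Fin N → E3) {Ω : Finset (Fin N)} {e : Fin M ↪ Fin N}
    (hΩe : Finset.univ.map e = Ω) {θf θc R₀ R : ℝ} (hθf : 0 ≤ θf) (hθc : 0 ≤ θc) (hR₀ : 0 ≤ R₀)
    (hR : R₀ + 5 / 4 ≤ R)
    (hΩ : ∀ i ∈ Ω, LooseGoodShell θc
      ((Measure.count : Measure E3).restrict ((fun z => z - y i) '' Set.range y))) :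
    (Nat.card {i : Fin N // i ∈ Ω ∧
        ¬ LooseGoodShell θf ((Measure.count : Measure E3).restrict ((fun z => z - y i) '' Set.range y))} : ℝ) ≤
      (Nat.card {a : Fin M //
          ¬ LooseGoodShell θf
              ((Measure.count : Measure E3).restrict ((fun z => z - y (e a)) '' Set.range (y ∘ e))) ∧
          ∀ b : Fin M, dist (y (e a)) (y (e b)) ≤ R₀ →
            LooseGoodShell θc
              ((Measure.count : Measure E3).restrict ((fun z => z - y (e b)) '' Set.range (y ∘ e)))} : ℝ) +
        Nat.card {i : Fin N // i ∈ Ω ∧ ∃ j : Fin N, j ∉ Ω ∧ dist (y i) (y j) ≤ R} := by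
  exact_mod_cast card_le_of_imp hΩe
    (P := fun i => ¬ LooseGoodShell θf
      ((Measure.count : Measure E3).restrict ((fun z => z - y i) '' Set.range y)))
    (D := fun i => ∃ j : Fin N, j ∉ Ω ∧ dist (y i) (y j) ≤ R)
    (Q := fun a => ¬ LooseGoodShell θf ((Measure.count : Measure E3).restrict
        ((fun z => z - y (e a)) '' Set.range (y ∘ e))) ∧
      ∀ b : Fin M, dist (y (e a)) (y (e b)) ≤ R₀ →
        LooseGoodShell θc ((Measure.count : Measure E3).restrict ((fun z => z - y (e b)) '' Set.range (y ∘ e))))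
    fun a hP hD => looseFineBad_transfer₂ y hΩe hθf hθc hR₀ hR hΩ a hP hD

/-- **Two-level in-situ transfer** (after `InSituTransfer.stub_inSituTransfer`): `ClusterCoerciveAt θc θf` (`θc, θf ≥ 0`)
gives, with the same `c`, `c·#{i ∈ Ω : θf-bad} − C·#(R-boundary of Ω) − ε·#Ω ≤ Σ_{i∈Ω} (𝓔ⁱ(y)/2 − e*)` on every
`θc`-loosely good index set `Ω` (`R = R₀ + 5/4 + 13500/ε`, `C = c + C₀ + (6R+1)³/24`). -/
theorem localGap_of_clusterCoerciveAt {θc θf : ℝ} (hθc : 0 ≤ θc) (hθf : 0 ≤ θf) (hA : ClusterCoerciveAt θc θf) :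
    ∃ c : ℝ, 0 < c ∧ ∀ ε : ℝ, 0 < ε → ∃ R : ℝ, 0 < R ∧ ∃ C : ℝ, 0 ≤ C ∧
      ∀ (N : ℕ) (y : Fin N → E3), Function.Injective y →
        (∀ i j : Fin N, i ≠ j → (1 : ℝ) / 3 ≤ dist (y i) (y j)) →
        ∀ Ω : Finset (Fin N),
          (∀ i ∈ Ω, LooseGoodShell θc
            ((Measure.count : Measure E3).restrict ((fun z => z - y i) '' Set.range y))) →
          c * (Nat.card {i : Fin N // i ∈ Ω ∧
                ¬ LooseGoodShell θf ((Measure.count : Measure E3).restrict ((fun z => z - y i) '' Set.range y))} : ℝ)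
            - C * (Nat.card {i : Fin N // i ∈ Ω ∧ ∃ j : Fin N, j ∉ Ω ∧ dist (y i) (y j) ≤ R} : ℝ)
            - ε * (Ω.card : ℝ)
          ≤ ∑ i ∈ Ω, (siteEnergy lennardJones y i / 2 - eStar) := by
  obtain ⟨c, hc, hA⟩ := hA
  refine ⟨c, hc, fun ε hε => ?_⟩
  obtain ⟨R₀, hR₀, C₀, hC₀, hA'⟩ := hA (ε / 2) (half_pos hε)
  obtain ⟨R, hRdef⟩ : ∃ R : ℝ, R = R₀ + 5 / 4 + 13500 / ε := ⟨_, rfl⟩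
  have hε' : (0 : ℝ) ≤ 13500 / ε := by positivity
  have hR54 : R₀ + 5 / 4 ≤ R := by rw [hRdef]; linarith
  have hR3 : (1 : ℝ) / 3 ≤ R := by linarith
  have hRpos : 0 < R := by linarith
  have hRε : 13500 * R⁻¹ ^ 2 ≤ ε := by
    have h1 : 13500 / ε ≤ R := by rw [hRdef]; linarith
    have h2 : 13500 ≤ R * ε := (div_le_iff₀ hε).1 h1
    have h3 : 0 ≤ ε * R * (R - 1) := mul_nonneg (mul_nonneg hε.le hRpos.le) (by linarith)
    rw [inv_pow, ← div_eq_mul_inv, div_le_iff₀ (by positivity : (0 : ℝ) < R ^ 2)]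
    nlinarith
  refine ⟨R, hRpos, c + C₀ + (6 * R + 1) ^ 3 / 24, by positivity, fun N y hy hsep Ω hΩ => ?_⟩
  set e : Fin Ω.card ↪ Fin N := (Ω.orderEmbOfFin rfl).toEmbedding with he
  have hΩe : Finset.univ.map e = Ω := Finset.map_orderEmbOfFin_univ Ω rfl
  have hzinj : Function.Injective (y ∘ e) := hy.comp e.injective
  have hzsep : ∀ a b : Fin Ω.card, a ≠ b → (1 : ℝ) / 3 ≤ dist ((y ∘ e) a) ((y ∘ e) b) :=
    fun a b hab => hsep (e a) (e b) fun h => hab (e.injective h)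
  have hz := hA' Ω.card (y ∘ e) hzinj hzsep
  simp only [Function.comp_apply] at hz
  have hE := sum_siteEnergy_eq y hΩe
  have hX := cross_sum_ge y hy hsep Ω hR3
  have h5a := card_looseFineBad_le₂ y hΩe hθf hθc hR₀.le hR54 hΩ
  have h5b := card_coarseBad_le y hΩe hθc (by linarith : (5 : ℝ) / 4 ≤ R) hΩ
  have hsumΩ : ∑ i ∈ Ω, (siteEnergy lennardJones y i / 2 - eStar) =
      (∑ i ∈ Ω, siteEnergy lennardJones y i) / 2 - eStar * Ω.card := by
    rw [Finset.sum_sub_distrib, Finset.sum_const, nsmul_eq_mul, Finset.sum_div, mul_comm]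
  have hM0 : (0 : ℝ) ≤ Ω.card := Nat.cast_nonneg _
  have h1 := mul_le_mul_of_nonneg_left h5a hc.le
  have h2 := mul_le_mul_of_nonneg_left h5b hC₀
  have h3 := mul_le_mul_of_nonneg_right hRε hM0
  rw [hsumΩ]
  linarith

/-- **Two-level periodic assembly** (after p138462): the in-situ local inequality from level `θc` to level `θf`
(`θc, θf ≥ 0`) gives `CoarseToFineAt θc θf` (`exists_blocks₂` + `le_interactionEnergy_of_local` with `Pc/Pf := LooseGoodShell θc/θf`). -/
theorem coarseToFineAt_of_localGap {θc θf : ℝ} (hθc : 0 ≤ θc) (hθf : 0 ≤ θf)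
    (hH : ∃ c : ℝ, 0 < c ∧ ∀ ε : ℝ, 0 < ε → ∃ R : ℝ, 0 < R ∧ ∃ C : ℝ, 0 ≤ C ∧
      ∀ (N : ℕ) (y : Fin N → E3), Function.Injective y →
        (∀ i j : Fin N, i ≠ j → (1 : ℝ) / 3 ≤ dist (y i) (y j)) →
        ∀ Ω : Finset (Fin N),
          (∀ i ∈ Ω, LooseGoodShell θc
            ((Measure.count : Measure E3).restrict ((fun z => z - y i) '' Set.range y))) →
          c * (Nat.card {i : Fin N // i ∈ Ω ∧
                ¬ LooseGoodShell θf ((Measure.count : Measure E3).restrict ((fun z => z - y i) '' Set.range y))} : ℝ)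
            - C * (Nat.card {i : Fin N // i ∈ Ω ∧ ∃ j : Fin N, j ∉ Ω ∧ dist (y i) (y j) ≤ R} : ℝ)
            - ε * (Ω.card : ℝ)
          ≤ ∑ i ∈ Ω, (siteEnergy lennardJones y i / 2 - eStar)) :
    CoarseToFineAt θc θf := by
  obtain ⟨c, hc, hH⟩ := hH
  intro t ht
  obtain ⟨R, hR, C, hC, hloc⟩ := hH (c * t / 8) (by positivity)
  obtain ⟨M, hM⟩ : ∃ M : ℝ, M = (|eStar| + c + 30375 / 2) * (6 * R + 1) ^ 3 + C * (12 * R + 1) ^ 3 :=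
    ⟨_, rfl⟩
  have hM0 : 0 ≤ M := by rw [hM]; positivity
  have hden : 0 < c + 1 + 2 * M := by positivity
  obtain ⟨s, hs_def⟩ : ∃ s : ℝ, s = c * t / 8 / (c + 1 + 2 * M) := ⟨_, rfl⟩
  have hs : 0 < s := by rw [hs_def]; positivity
  have hsM : (c + 1 + 2 * M) * s = c * t / 8 := by rw [hs_def]; field_simp
  refine ⟨s, hs, c * t / 2, by positivity, fun Q hQ hfine hcoarse => ?_⟩
  unfold looseBadMotifCount rerooted at hfine hcoarse
  obtain ⟨N, hN, y, hy, hsep, hE, hbad₁, hbad₂⟩ :=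
    exists_blocks₂ (G₁ := LooseGoodShell θf) (G₂ := LooseGoodShell θc)
      (fun h => NecessityBlocks.looseGood_congr_of_local hθf h)
      (fun h => NecessityBlocks.looseGood_congr_of_local hθc h)
      Q hQ t s hfine hcoarse.le hs
  have hA := le_interactionEnergy_of_local y hy hsep
    (fun i => LooseGoodShell θc ((Measure.count : Measure E3).restrict ((fun z => z - y i) '' Set.range y)))
    (fun i => LooseGoodShell θf ((Measure.count : Measure E3).restrict ((fun z => z - y i) '' Set.range y)))
    (e₀ := eStar) hc.le hC hR.le (by positivity) (fun Ω hΩ => hloc N y hy hsep Ω hΩ)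
  rw [← hM] at hA
  have hNr : (0 : ℝ) < N := by exact_mod_cast hN
  have h1 := mul_le_mul_of_nonneg_left hbad₂ hM0
  have h2 := mul_le_mul_of_nonneg_left hbad₁ hc.le
  have h3 : (c + 1 + 2 * M) * s * N = c * t / 8 * N := by rw [hsM]
  have h4 : 0 ≤ c * t * N := by positivity
  have key : (N : ℝ) * (eStar + c * t / 2) ≤ N * Q.energyPerParticle lennardJones := by
    linarith [hA, hE, h1, h2, h3, h4]
  exact le_of_mul_le_mul_left key hNr

/-- **Two-level transfer, composed**: `ClusterCoerciveAt θc θf → CoarseToFineAt θc θf` for `θc, θf ≥ 0`. -/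
theorem coarseToFineAt_of_clusterCoerciveAt {θc θf : ℝ} (hθc : 0 ≤ θc) (hθf : 0 ≤ θf)
    (h : ClusterCoerciveAt θc θf) : CoarseToFineAt θc θf :=
  coarseToFineAt_of_localGap hθc hθf (localGap_of_clusterCoerciveAt hθc hθf h)

/-! ## Compositions: cluster rungs along a ladder + the coarse gap give every loosened gap, hence the crux -/

/-- Cluster rungs along an antitone ladder from `1/20` give the e*-free child. -/
theorem child_of_clusterLadder (θ : ℕ → ℝ) (h0 : θ 0 = 1 / 20) (hpos : ∀ k, 0 ≤ θ k)
    (hanti : ∀ k, θ (k + 1) ≤ θ k) (hreach : ∀ η : ℝ, 0 < η → ∃ k, θ k ≤ η)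
    (hrung : ∀ k, ClusterCoerciveAt (θ k) (θ (k + 1))) :
    ∀ θ' : ℝ, 0 < θ' → θ' ≤ 1 / 20 → CoarseToFineAt (1 / 20) θ' :=
  child_of_ladder θ h0 hpos hanti hreach fun k =>
    coarseToFineAt_of_clusterCoerciveAt (hpos k) (hpos (k + 1)) (hrung k)

/-- The level-`1/20` cluster family (the registered stub `stub_clusterCoercivityLoose`) gives the e*-free child directly
(one rung per target level). -/
theorem child_of_clusterFamily (h : ∀ θ : ℝ, 0 < θ → θ ≤ 1 / 20 → ClusterCoerciveAt (1 / 20) θ) :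
    ∀ θ' : ℝ, 0 < θ' → θ' ≤ 1 / 20 → CoarseToFineAt (1 / 20) θ' :=
  fun θ' hθ' hθ'20 => coarseToFineAt_of_clusterCoerciveAt (by norm_num) hθ'.le (h θ' hθ' hθ'20)

/-- **`ShellGap (1/20)` + cluster rungs along a ladder ⇒ every `ShellGap θ`, `θ ∈ (0, 1/10]`.** -/
theorem shellGapAll_of_coarse_and_clusterLadder (hc : ShellGap (1 / 20))
    (θ : ℕ → ℝ) (h0 : θ 0 = 1 / 20) (hpos : ∀ k, 0 ≤ θ k)
    (hanti : ∀ k, θ (k + 1) ≤ θ k) (hreach : ∀ η : ℝ, 0 < η → ∃ k, θ k ≤ η)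
    (hrung : ∀ k, ClusterCoerciveAt (θ k) (θ (k + 1))) :
    ∀ θ' : ℝ, 0 < θ' → θ' ≤ 1 / 10 → ShellGap θ' :=
  shellGapAll_of_coarse_and_child hc (child_of_clusterLadder θ h0 hpos hanti hreach hrung)

/-- **`ShellGap (1/20)` + cluster rungs along a ladder ⇒ the crux `MinimiserShells`** (through
`ExactResidual.minimiserShells_of_shellGapAll`, p149424). -/
theorem minimiserShells_of_coarse_and_clusterLadder (hc : ShellGap (1 / 20))
    (θ : ℕ → ℝ) (h0 : θ 0 = 1 / 20) (hpos : ∀ k, 0 ≤ θ k)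
    (hanti : ∀ k, θ (k + 1) ≤ θ k) (hreach : ∀ η : ℝ, 0 < η → ∃ k, θ k ≤ η)
    (hrung : ∀ k, ClusterCoerciveAt (θ k) (θ (k + 1))) : MinimiserShells :=
  minimiserShells_of_shellGapAll (shellGapAll_of_coarse_and_clusterLadder hc θ h0 hpos hanti hreach hrung)

/-- **`ShellGap (1/20)` + the dyadic cluster rungs ⇒ the crux.** -/
theorem minimiserShells_of_coarse_and_dyadicClusterLadder (hc : ShellGap (1 / 20))
    (hrung : ∀ k : ℕ, ClusterCoerciveAt ((1 / 20 : ℝ) / 2 ^ k) ((1 / 20 : ℝ) / 2 ^ (k + 1))) : MinimiserShells := by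
  refine minimiserShells_of_coarse_and_clusterLadder hc (fun k => (1 / 20 : ℝ) / 2 ^ k) (by norm_num)
    (fun k => by positivity) (fun k => ?_) dyadic_reach hrung
  rw [pow_succ]
  exact div_le_div_of_nonneg_left (by norm_num) (by positivity) (le_mul_of_one_le_right (by positivity) (by norm_num))

/-- **Registered composition of line `exact-elastic-split` (lead c19)**: the coarse gap `ShellGap (1/20)` (open core) and
the dyadic cluster rungs `ClusterCoerciveAt ((1/20)/2^k) ((1/20)/2^(k+1))`, `k : ℕ` (e*-free, one finite-cluster statement
per rung) give the crux `MinimiserShells`. -/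
theorem minimiserShells_of_coarseGap_and_dyadicRungs : ShellGap (1 / 20) → (∀ k : ℕ, ClusterCoerciveAt ((1 / 20 : ℝ) / 2 ^ k) ((1 / 20 : ℝ) / 2 ^ (k + 1))) → MinimiserShells :=
  minimiserShells_of_coarse_and_dyadicClusterLadder

end Summit.AtomisticToContinuum.Crystallization.Theorems.PalmUnimodularRigidityMinimiserShells.TwoLevel
end
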